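import Literature.Barriers.NavierStokesRegularity.SupNormCalderonZygmundLacunary
import Literature.Analysis.FluidPDE.VorticityCalculus
import Literature.Analysis.FluidPDE.VectorCalculusProofs
import HarnessLib

/-!
# Witness families for the barrier `SupNormCalderonZygmundFailure`

Barrier catalogue `Literature/Barriers/NavierStokesRegularity/` (D-0021) — second WITNESS MODULE of the
entry `SupNormCalderonZygmundFailure` (cell `ns-claims`, D-0090, seat `ns-claims-salvage-p1`; everything
PROVED, zero fact debt). From the scalar lacunary family `u_N` of `SupNormCalderonZygmundLacunary.lean`
(Gilbarg–Trudinger, Problem 4.9 (a): `u_N ∈ C_c^∞(ℝ³)`, `sup|Δu_N| ≤ M`, every second partial except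
`∂₀∂₁` bounded uniformly in `N`, `∂₀∂₁u_N(0) = N`) it builds the three families the entry negates:

* (1) `exists_hessian_witness` — `u = u_N` itself: `sup|Δu| ≤ M`, `∂₀∂₁u(0) ≥ K`, `‖D²u(0)‖ ≥ K`
  (`∂ⱼ∂ₖ = −RⱼRₖΔ`, Grafakos 2008 Prop. 5.1.17: `R₀R₁` is unbounded on `L^∞` on `C_c^∞` data);
* (3) `exists_velocity_gradient_witness` — the divergence-free `U = (∂₁u_N, −∂₀u_N, 0) = curl(u_N e₂)`
  (`SupNormCZ.vel`): its curl `(∂₂∂₀u_N, ∂₂∂₁u_N, −∂₀²u_N − ∂₁²u_N)` contains only bounded directions,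
  its gradient at `0` the entry `∂₀∂₁u_N(0) = N` (the log of Beale–Kato–Majda / Majda–Bertozzi Prop. 3.8
  cannot be dropped);
* (2) `exists_hodge_supNorm_witness` — the compactly supported Helmholtz–Hodge triple `φ = φ₁ + φ₂`,
  `φ = (Δu_N)e₀` (`SupNormCZ.hodge`), `φ₂ = ∇∂₀u_N` (`hodge₂`, curl-free),
  `φ₁ = curl(∂₁u_N e₂ − ∂₂u_N e₁)` (`hodge₁`, divergence-free): `sup‖φ‖ ≤ M` while
  `‖φ₁(0)‖, ‖φ₂(0)‖ ≥ N`; all three fields are `C_c^∞`, hence `HasRapidSpatialDecay`, and `(φ₁, φ₂)` is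
  the decaying Hodge pair of `φ`, `φ₁ = ℙφ` (Lemarié-Rieusset 2016, Ch. 6 Def. 6.4 / Prop. 6.2).

The identities are second-derivative bookkeeping (`curl`, `div`, `∇` of fields whose components are
first partials of `u_N`; symmetry of the Hessian cancels the off-diagonal entries; tree
`divergence_curl_eq_zero_holds`, `curl_gradient_eq_zero_holds`, `contDiff_curl`, `hasCompactSupport_curl`).
References and the structured barrier block: see the entry module. WHAT THIS IS NOT: not a claim about NS
regularity or blow-up; not a claim about any author beyond the typed locator.
-/

noncomputable section

open Set Filter Topology InnerProductSpace Function Metric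
open scoped Laplacian ContDiff RealInnerProductSpace

namespace Literature.Barriers.NavierStokesRegularity.SupNormCZ

open Literature.Analysis.FluidPDE

/-- Local notation for physical space `ℝ³ = EuclideanSpace ℝ (Fin 3)`. -/
local notation "E3" => EuclideanSpace ℝ (Fin 3)

/-! ### Calculus helpers -/

/-- For a `C²` function, `∂_c∂_a f(x) = D²f(x)(c, a)`. [folklore] -/
private theorem D2_eq_iteratedFDeriv {f : E3 → ℝ} (hf : ContDiff ℝ 2 f) (a c x : E3) :
    D2 f a c x = iteratedFDeriv ℝ 2 f x ![c, a] := by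
  have hd : DifferentiableAt ℝ (fderiv ℝ f) x :=
    ((hf.fderiv_right (m := 1) le_rfl).differentiable one_ne_zero) x
  rw [iteratedFDeriv_two_apply, D2, fderiv_clm_apply hd (differentiableAt_const a)]
  simp

/-- Symmetry of the Hessian of a `C²` function: `∂_c∂_a f = ∂_a∂_c f`. [folklore] -/
private theorem D2_comm {f : E3 → ℝ} (hf : ContDiff ℝ 2 f) (a c x : E3) :
    D2 f a c x = D2 f c a x := by
  rw [D2_eq_iteratedFDeriv hf, D2_eq_iteratedFDeriv hf, iteratedFDeriv_two_apply,
    iteratedFDeriv_two_apply]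
  exact (hf.contDiffAt.isSymmSndFDerivAt (n := 2) (by simp)) _ _

/-- `|∂_c∂_a f(x)| ≤ ‖D²f(x)‖ ‖c‖ ‖a‖`. [folklore] -/
private theorem abs_D2_le_norm_iteratedFDeriv {f : E3 → ℝ} (hf : ContDiff ℝ 2 f) (a c x : E3) :
    |D2 f a c x| ≤ ‖iteratedFDeriv ℝ 2 f x‖ * ‖c‖ * ‖a‖ := by
  rw [D2_eq_iteratedFDeriv hf, ← Real.norm_eq_abs]
  refine (ContinuousMultilinearMap.le_opNorm _ _).trans_eq ?_
  simp [Fin.prod_univ_two, mul_assoc]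

/-- First partials of a smooth function are smooth. [folklore] -/
private theorem contDiff_fderiv_apply_const {f : E3 → ℝ} (hf : ContDiff ℝ ∞ f) (a : E3) :
    ContDiff ℝ ∞ fun y => fderiv ℝ f y a :=
  (hf.fderiv_right (m := ∞) (by norm_cast)).clm_apply contDiff_const

/-- First partials of a compactly supported function are compactly supported. [folklore] -/
private theorem hasCompactSupport_fderiv_apply_const {f : E3 → ℝ} (hf : HasCompactSupport f)
    (a : E3) : HasCompactSupport fun y => fderiv ℝ f y a :=
  hf.fderiv_apply (𝕜 := ℝ) a

/-- `‖a e₀ + b e₁ + c e₂‖ ≤ |a| + |b| + |c|`. [folklore] -/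
private theorem norm_combo_le (a b c : ℝ) : ‖a • e 0 + b • e 1 + c • e 2‖ ≤ |a| + |b| + |c| := by
  calc ‖a • e 0 + b • e 1 + c • e 2‖ ≤ ‖a • e 0‖ + ‖b • e 1‖ + ‖c • e 2‖ := norm_add₃_le
    _ = |a| + |b| + |c| := by simp [norm_smul]

/-- Components of a gradient on `ℝ³`: `(∇g)ᵢ = ∂ᵢ g`. [folklore] -/
private theorem gradient_apply_coord (g : E3 → ℝ) (x : E3) (i : Fin 3) :
    gradient g x i = fderiv ℝ g x (e i) := by
  have h : ⟪gradient g x, e i⟫ = fderiv ℝ g x (e i) := by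
    rw [gradient, InnerProductSpace.toDual_symm_apply]
  rw [← h, e, EuclideanSpace.inner_single_right]
  simp

/-- A smooth compactly supported field on `ℝ³` is rapidly decaying in the sense of the Clay statement's
condition (4), `(1 + |x|)^K |Dⁿφ(x)| ≤ C_{n,K}` (each such function is continuous with compact support).
[cite: FeffermanClay2006, statement (A) condition (4)] -/
theorem hasRapidSpatialDecay_of_hasCompactSupport {φ : E3 → E3} (hsm : ContDiff ℝ ∞ φ)
    (hc : HasCompactSupport φ) : HasRapidSpatialDecay φ := by
  intro n K
  have hcont : Continuous fun x => (1 + ‖x‖) ^ K * ‖iteratedFDeriv ℝ n φ x‖ :=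
    ((continuous_const.add continuous_norm).pow K).mul
      (hsm.continuous_iteratedFDeriv (m := n) (mod_cast le_top)).norm
  have hsupp : HasCompactSupport fun x => (1 + ‖x‖) ^ K * ‖iteratedFDeriv ℝ n φ x‖ :=
    ((hc.iteratedFDeriv n).norm).mul_left
  obtain ⟨C, hC⟩ := hcont.bounded_above_of_compact_support hsupp
  refine ⟨C, fun x => ?_⟩
  have h := hC x
  rwa [Real.norm_eq_abs, abs_of_nonneg (by positivity)] at h

/-! ### (1) The Hessian is not sup-norm controlled by the Laplacian -/

/-- **Witness family (1).** There is `M > 0` such that for every `K` some `u ∈ C_c^∞(ℝ³;ℝ)` has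
`sup|Δu| ≤ M` but `∂₀∂₁u(0) ≥ K` (hence `‖D²u(0)‖ ≥ K`): the lacunary sums of Gilbarg–Trudinger
Problem 4.9 (a). Since `∂ⱼ∂ₖu = −RⱼRₖΔu` (Grafakos Prop. 5.1.17) this says `R₀R₁` is unbounded on
`L^∞` already on `C_c^∞` data. [cite: GilbargTrudinger2001, Ch. 4 Problem 4.9 (a)]
[cite: Grafakos2008, Prop. 5.1.17] -/
theorem exists_hessian_witness : ∃ M : ℝ, 0 < M ∧ ∀ K : ℝ, ∃ u : E3 → ℝ,
    ContDiff ℝ ∞ u ∧ HasCompactSupport u ∧ (∀ x, |(Δ u) x| ≤ M) ∧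
    K ≤ fderiv ℝ (fun y => fderiv ℝ u y (EuclideanSpace.single 1 1)) 0 (EuclideanSpace.single 0 1) ∧
    K ≤ ‖iteratedFDeriv ℝ 2 u 0‖ := by
  obtain ⟨M, hM, hΔ⟩ := exists_abs_laplacian_lac_le
  refine ⟨M, hM, fun K => ?_⟩
  obtain ⟨N, hN⟩ := exists_nat_ge K
  have h10 : D2 (lac N) (e 1) (e 0) 0 = N := D2_lac_e1_e0_zero N
  refine ⟨lac N, lac_contDiff N, lac_hasCompactSupport N, hΔ N, ?_, ?_⟩
  · show K ≤ D2 (lac N) (e 1) (e 0) 0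
    rw [h10]; exact hN
  · have h := abs_D2_le_norm_iteratedFDeriv (lac_contDiff_two N) (e 1) (e 0) 0
    rw [h10, norm_e, norm_e, mul_one, mul_one, Nat.abs_cast] at h
    exact hN.trans h

/-! ### (3) The velocity gradient is not sup-norm controlled by the vorticity -/

/-- The divergence-free test velocity `U_N = (∂₁u_N, −∂₀u_N, 0) = curl (u_N e₂)`. [folklore] -/
def vel (N : ℕ) (x : E3) : E3 :=
  (fderiv ℝ (lac N) x (e 1)) • e 0 - (fderiv ℝ (lac N) x (e 0)) • e 1

/-- `U_N` is smooth. [folklore] -/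
private theorem vel_contDiff (N : ℕ) : ContDiff ℝ ∞ (vel N) :=
  ((contDiff_fderiv_apply_const (lac_contDiff N) (e 1)).smul contDiff_const).sub
    ((contDiff_fderiv_apply_const (lac_contDiff N) (e 0)).smul contDiff_const)

/-- `U_N` has compact support. [folklore] -/
private theorem vel_hasCompactSupport (N : ℕ) : HasCompactSupport (vel N) :=
  ((hasCompactSupport_fderiv_apply_const (lac_hasCompactSupport N) (e 1)).smul_right
    (f' := fun _ => e 0)).sub
    ((hasCompactSupport_fderiv_apply_const (lac_hasCompactSupport N) (e 0)).smul_right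
      (f' := fun _ => e 1))

/-- Components of `DU_N(x) h = ∂_h∂₁u_N(x) e₀ − ∂_h∂₀u_N(x) e₁`. [folklore] -/
private theorem fderiv_vel_apply_coord (N : ℕ) (x h : E3) (i : Fin 3) :
    fderiv ℝ (vel N) x h i =
      D2 (lac N) (e 1) h x * (e 0 i) - D2 (lac N) (e 0) h x * (e 1 i) := by
  have hd : ∀ a, DifferentiableAt ℝ (fun y => fderiv ℝ (lac N) y a) x := fun a =>
    ((contDiff_fderiv_apply_const (lac_contDiff N) a).differentiable (by simp)) x
  have h1 : HasFDerivAt (vel N)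
      ((fderiv ℝ (fun y => fderiv ℝ (lac N) y (e 1)) x).smulRight (e 0) -
        (fderiv ℝ (fun y => fderiv ℝ (lac N) y (e 0)) x).smulRight (e 1)) x :=
    ((hd (e 1)).hasFDerivAt.smul_const (e 0)).sub ((hd (e 0)).hasFDerivAt.smul_const (e 1))
  rw [h1.fderiv]
  simp [D2]

/-- `U_N` is divergence free (`∂₀∂₁ = ∂₁∂₀`). [folklore] -/
private theorem vel_isDivFree (N : ℕ) : VectorCalculus.IsDivFree (vel N) := by
  intro x
  rw [divergence_eq_sum_inner_fderiv (EuclideanSpace.basisFun (Fin 3) ℝ), Fin.sum_univ_three]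
  simp only [EuclideanSpace.basisFun_apply, EuclideanSpace.inner_single_left, map_one, one_mul]
  have he : ∀ i : Fin 3, EuclideanSpace.single i (1 : ℝ) = e i := fun i => rfl
  simp only [he, fderiv_vel_apply_coord, e_apply]
  simp [D2_comm (lac_contDiff_two N) (e 1) (e 0) x]

/-- The vorticity of `U_N`: `curl U_N = (∂₂∂₀u_N, ∂₂∂₁u_N, −∂₀∂₀u_N − ∂₁∂₁u_N)` — only GOOD
directions occur. [folklore] -/
private theorem curl_vel (N : ℕ) (x : E3) :
    curl (vel N) x = (D2 (lac N) (e 0) (e 2) x) • e 0 + (D2 (lac N) (e 1) (e 2) x) • e 1 +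
      (-(D2 (lac N) (e 0) (e 0) x + D2 (lac N) (e 1) (e 1) x)) • e 2 := by
  have he : ∀ i : Fin 3, EuclideanSpace.single i (1 : ℝ) = e i := fun i => rfl
  ext i
  fin_cases i
  · simp [curl, he, fderiv_vel_apply_coord]
  · simp [curl, he, fderiv_vel_apply_coord]
  · simp [curl, he, fderiv_vel_apply_coord]
    ring

/-- **Witness family (3).** There is `M > 0` such that for every `K` some smooth, compactly supported,
divergence-free `U : ℝ³ → ℝ³` has `sup ‖curl U‖ ≤ M` but `‖DU(0)‖ ≥ K`: the missing logarithm of the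
Beale–Kato–Majda potential-theory estimate `|∇v|_∞ ≤ c(1 + ln⁺‖v‖₃ + ln⁺‖ω‖₀)(1 + |ω|_∞)` cannot be
removed. [cite: MajdaBertozziCUP2002, Prop. 3.8 (3.83) and Lemma 4.6 (4.35)]
[cite: GilbargTrudinger2001, Ch. 4 Problem 4.9 (a)] -/
theorem exists_velocity_gradient_witness : ∃ M : ℝ, 0 < M ∧ ∀ K : ℝ, ∃ U : E3 → E3,
    ContDiff ℝ ∞ U ∧ HasCompactSupport U ∧ VectorCalculus.IsDivFree U ∧
    (∀ x, ‖curl U x‖ ≤ M) ∧ K ≤ ‖fderiv ℝ U 0‖ := by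
  obtain ⟨B₁, h1, hB₁⟩ := exists_abs_D2_lac_le (a := e 0) (c := e 2) (by simp)
  obtain ⟨B₂, h2, hB₂⟩ := exists_abs_D2_lac_le (a := e 1) (c := e 2) (by simp)
  obtain ⟨B₃, h3, hB₃⟩ := exists_abs_D2_lac_le (a := e 0) (c := e 0) (by simp)
  obtain ⟨B₄, h4, hB₄⟩ := exists_abs_D2_lac_le (a := e 1) (c := e 1) (by simp)
  refine ⟨B₁ + B₂ + B₃ + B₄ + 1, by linarith, fun K => ?_⟩
  obtain ⟨N, hN⟩ := exists_nat_ge K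
  refine ⟨vel N, vel_contDiff N, vel_hasCompactSupport N, vel_isDivFree N, fun x => ?_, ?_⟩
  · rw [curl_vel]
    refine (norm_combo_le _ _ _).trans ?_
    have := hB₁ N x; have := hB₂ N x; have := hB₃ N x; have := hB₄ N x
    have h5 : |-(D2 (lac N) (e 0) (e 0) x + D2 (lac N) (e 1) (e 1) x)| ≤ B₃ + B₄ := by
      rw [abs_neg]; exact (abs_add_le _ _).trans (by linarith)
    linarith
  · -- `‖DU(0)‖ ≥ |(DU(0) e₀)₀| = ∂₀∂₁ u_N (0) = N`
    have h10 : D2 (lac N) (e 1) (e 0) 0 = N := D2_lac_e1_e0_zero N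
    have hc : fderiv ℝ (vel N) 0 (e 0) 0 = N := by
      rw [fderiv_vel_apply_coord, h10]; simp
    calc K ≤ N := hN
      _ = |fderiv ℝ (vel N) 0 (e 0) 0| := by rw [hc, Nat.abs_cast]
      _ ≤ ‖fderiv ℝ (vel N) 0 (e 0)‖ := by
          rw [← Real.norm_eq_abs]; exact PiLp.norm_apply_le _ _
      _ ≤ ‖fderiv ℝ (vel N) 0‖ * ‖e 0‖ := ContinuousLinearMap.le_opNorm _ _
      _ = ‖fderiv ℝ (vel N) 0‖ := by rw [norm_e, mul_one]

/-! ### (2) The Helmholtz–Hodge (Leray) components are not sup-norm controlled by the field -/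

/-- The potential `W_N = (0, −∂₂u_N, ∂₁u_N) = −curl (u_N e₀)` of the solenoidal part. [folklore] -/
def hodgeW (N : ℕ) (x : E3) : E3 :=
  (fderiv ℝ (lac N) x (e 1)) • e 2 - (fderiv ℝ (lac N) x (e 2)) • e 1

/-- The scalar potential `q_N = ∂₀u_N` of the gradient part. [folklore] -/
def hodgeQ (N : ℕ) (x : E3) : ℝ := fderiv ℝ (lac N) x (e 0)

/-- The solenoidal part `φ₁ = curl W_N` (`= ℙφ`). [folklore] -/
def hodge₁ (N : ℕ) : E3 → E3 := curl (hodgeW N)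

/-- The gradient part `φ₂ = ∇q_N = ∇∂₀u_N`. [folklore] -/
def hodge₂ (N : ℕ) : E3 → E3 := gradient (hodgeQ N)

/-- The field `φ = φ₁ + φ₂` (it equals `(Δu_N) e₀`, `hodge_eq`). [folklore] -/
def hodge (N : ℕ) (x : E3) : E3 := hodge₁ N x + hodge₂ N x

/-- `W_N` is smooth. [folklore] -/
private theorem hodgeW_contDiff (N : ℕ) : ContDiff ℝ ∞ (hodgeW N) :=
  ((contDiff_fderiv_apply_const (lac_contDiff N) (e 1)).smul contDiff_const).sub
    ((contDiff_fderiv_apply_const (lac_contDiff N) (e 2)).smul contDiff_const)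

/-- `W_N` has compact support. [folklore] -/
private theorem hodgeW_hasCompactSupport (N : ℕ) : HasCompactSupport (hodgeW N) :=
  ((hasCompactSupport_fderiv_apply_const (lac_hasCompactSupport N) (e 1)).smul_right
    (f' := fun _ => e 2)).sub
    ((hasCompactSupport_fderiv_apply_const (lac_hasCompactSupport N) (e 2)).smul_right
      (f' := fun _ => e 1))

/-- `q_N` is smooth. [folklore] -/
private theorem hodgeQ_contDiff (N : ℕ) : ContDiff ℝ ∞ (hodgeQ N) :=
  contDiff_fderiv_apply_const (lac_contDiff N) (e 0)

/-- `DW_N(x) h = ∂_h∂₁u_N e₂ − ∂_h∂₂u_N e₁`, componentwise. [folklore] -/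
private theorem fderiv_hodgeW_apply_coord (N : ℕ) (x h : E3) (i : Fin 3) :
    fderiv ℝ (hodgeW N) x h i =
      D2 (lac N) (e 1) h x * (e 2 i) - D2 (lac N) (e 2) h x * (e 1 i) := by
  have hd : ∀ a, DifferentiableAt ℝ (fun y => fderiv ℝ (lac N) y a) x := fun a =>
    ((contDiff_fderiv_apply_const (lac_contDiff N) a).differentiable (by simp)) x
  have h1 : HasFDerivAt (hodgeW N)
      ((fderiv ℝ (fun y => fderiv ℝ (lac N) y (e 1)) x).smulRight (e 2) -
        (fderiv ℝ (fun y => fderiv ℝ (lac N) y (e 2)) x).smulRight (e 1)) x :=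
    ((hd (e 1)).hasFDerivAt.smul_const (e 2)).sub ((hd (e 2)).hasFDerivAt.smul_const (e 1))
  rw [h1.fderiv]
  simp [D2]

/-- `φ₁ = curl W_N = (∂₁∂₁u_N + ∂₂∂₂u_N, −∂₀∂₁u_N, −∂₀∂₂u_N)`. [folklore] -/
private theorem hodge₁_eq (N : ℕ) (x : E3) :
    hodge₁ N x = (D2 (lac N) (e 1) (e 1) x + D2 (lac N) (e 2) (e 2) x) • e 0 +
      (-D2 (lac N) (e 1) (e 0) x) • e 1 + (-D2 (lac N) (e 2) (e 0) x) • e 2 := by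
  have he : ∀ i : Fin 3, EuclideanSpace.single i (1 : ℝ) = e i := fun i => rfl
  ext i
  fin_cases i <;> simp [hodge₁, curl, he, fderiv_hodgeW_apply_coord]

/-- `φ₂ = ∇∂₀u_N = (∂₀∂₀u_N, ∂₁∂₀u_N, ∂₂∂₀u_N)`. [folklore] -/
private theorem hodge₂_eq (N : ℕ) (x : E3) :
    hodge₂ N x = (D2 (lac N) (e 0) (e 0) x) • e 0 + (D2 (lac N) (e 0) (e 1) x) • e 1 +
      (D2 (lac N) (e 0) (e 2) x) • e 2 := by
  have hq : hodgeQ N = fun y => fderiv ℝ (lac N) y (e 0) := rfl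
  ext i
  fin_cases i <;> simp [hodge₂, hq, gradient_apply_coord, D2]

/-- **The decomposed field is `(Δu_N) e₀`**: the off-diagonal entries cancel by the symmetry of the
Hessian, the diagonal ones add up to the Laplacian. [folklore] -/
private theorem hodge_eq (N : ℕ) (x : E3) : hodge N x = ((Δ (lac N)) x) • e 0 := by
  have hΔ : (Δ (lac N)) x = D2 (lac N) (e 0) (e 0) x + D2 (lac N) (e 1) (e 1) x +
      D2 (lac N) (e 2) (e 2) x := by
    rw [laplacian_eq_sum_fderiv_fderiv (EuclideanSpace.basisFun (Fin 3) ℝ) (lac_contDiff_two N) x,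
      Fin.sum_univ_three]
    simp only [EuclideanSpace.basisFun_apply]
    simp only [D2, e]
  rw [hodge, hodge₁_eq, hodge₂_eq, hΔ, D2_comm (lac_contDiff_two N) (e 1) (e 0),
    D2_comm (lac_contDiff_two N) (e 2) (e 0)]
  ext i
  fin_cases i
  · simp
    ring
  · simp
  · simp

/-- `φ₁` is smooth. [folklore] -/
private theorem hodge₁_contDiff (N : ℕ) : ContDiff ℝ ∞ (hodge₁ N) :=
  contDiff_curl (n := ⊤) ((hodgeW_contDiff N).of_le (by exact_mod_cast le_top))

/-- `φ₁` has compact support. [folklore] -/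
private theorem hodge₁_hasCompactSupport (N : ℕ) : HasCompactSupport (hodge₁ N) :=
  hasCompactSupport_curl (hodgeW_hasCompactSupport N)

/-- `φ₁ = curl W_N` is divergence free. [folklore] -/
private theorem hodge₁_isDivFree (N : ℕ) : VectorCalculus.IsDivFree (hodge₁ N) := fun x =>
  divergence_curl_eq_zero_holds (hodgeW N) ((hodgeW_contDiff N).of_le (by norm_cast)) x

/-- `φ₂` is smooth. [folklore] -/
private theorem hodge₂_contDiff (N : ℕ) : ContDiff ℝ ∞ (hodge₂ N) := by
  have h : hodge₂ N = (InnerProductSpace.toDual ℝ E3).symm ∘ fderiv ℝ (hodgeQ N) := rfl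
  rw [h]
  exact (InnerProductSpace.toDual ℝ E3).symm.contDiff.comp
    ((hodgeQ_contDiff N).fderiv_right (m := ∞) (by norm_cast))

/-- `φ₂` has compact support. [folklore] -/
private theorem hodge₂_hasCompactSupport (N : ℕ) : HasCompactSupport (hodge₂ N) := by
  have h : hodge₂ N = (InnerProductSpace.toDual ℝ E3).symm ∘ fderiv ℝ (hodgeQ N) := rfl
  rw [h]
  exact ((hasCompactSupport_fderiv_apply_const (lac_hasCompactSupport N) (e 0)).fderiv
    (𝕜 := ℝ)).comp_left (map_zero _)

/-- `φ₂ = ∇q_N` is curl free. [folklore] -/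
private theorem curl_hodge₂ (N : ℕ) (x : E3) : curl (hodge₂ N) x = 0 :=
  curl_gradient_eq_zero_holds (hodgeQ N) ((hodgeQ_contDiff N).of_le (by norm_cast)) x

/-- **Witness family (2).** There is `M > 0` such that for every `K` there are smooth compactly supported
(hence rapidly decaying) fields `φ = φ₁ + φ₂` on `ℝ³` with `div φ₁ = 0`, `curl φ₂ = 0`, `sup‖φ‖ ≤ M`, but
`‖φ₁(0)‖ ≥ K` and `‖φ₂(0)‖ ≥ K`. All three being compactly supported, `(φ₁, φ₂)` is the Helmholtz–Hodge
pair of `φ` with decaying curl-free part, i.e. `φ₁ = ℙφ` is the Leray projection (Lemarié-Rieusset, Def.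
6.4: the curl-free part vanishing at infinity is unique; Prop. 6.2: `ℙ = R∧(R∧·)`). So `ℙ` — an order-zero
Calderón–Zygmund operator — is not bounded on `L^∞`/`C₀`, already on `C_c^∞` data.
[cite: LemarieRieusset2016, Ch. 6 Def. 6.4 and Prop. 6.2] [cite: GilbargTrudinger2001, Ch. 4 Problem 4.9 (a)] -/
theorem exists_hodge_supNorm_witness : ∃ M : ℝ, 0 < M ∧ ∀ K : ℝ, ∃ φ φ₁ φ₂ : E3 → E3,
    ContDiff ℝ ∞ φ ∧ ContDiff ℝ ∞ φ₁ ∧ ContDiff ℝ ∞ φ₂ ∧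
    HasCompactSupport φ ∧ HasCompactSupport φ₁ ∧ HasCompactSupport φ₂ ∧
    HasRapidSpatialDecay φ ∧ HasRapidSpatialDecay φ₁ ∧ HasRapidSpatialDecay φ₂ ∧
    (∀ x, φ x = φ₁ x + φ₂ x) ∧ VectorCalculus.IsDivFree φ₁ ∧ (∀ x, curl φ₂ x = 0) ∧
    (∀ x, ‖φ x‖ ≤ M) ∧ K ≤ ‖φ₁ 0‖ ∧ K ≤ ‖φ₂ 0‖ := by
  obtain ⟨M, hM, hΔ⟩ := exists_abs_laplacian_lac_le
  refine ⟨M, hM, fun K => ?_⟩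
  obtain ⟨N, hN⟩ := exists_nat_ge K
  have hφ := (hodge₁_contDiff N).add (hodge₂_contDiff N)
  have hφc := (hodge₁_hasCompactSupport N).add (hodge₂_hasCompactSupport N)
  refine ⟨hodge N, hodge₁ N, hodge₂ N, hφ, hodge₁_contDiff N, hodge₂_contDiff N,
    hφc, hodge₁_hasCompactSupport N, hodge₂_hasCompactSupport N,
    hasRapidSpatialDecay_of_hasCompactSupport hφ hφc,
    hasRapidSpatialDecay_of_hasCompactSupport (hodge₁_contDiff N) (hodge₁_hasCompactSupport N),
    hasRapidSpatialDecay_of_hasCompactSupport (hodge₂_contDiff N) (hodge₂_hasCompactSupport N),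
    fun x => rfl, hodge₁_isDivFree N, curl_hodge₂ N, fun x => ?_, ?_, ?_⟩
  · rw [hodge_eq, norm_smul, norm_e, mul_one, Real.norm_eq_abs]
    exact hΔ N x
  · have h10 : D2 (lac N) (e 1) (e 0) 0 = N := D2_lac_e1_e0_zero N
    have hc : hodge₁ N 0 1 = -N := by rw [hodge₁_eq, h10]; simp
    calc K ≤ N := hN
      _ = ‖hodge₁ N 0 1‖ := by rw [hc, norm_neg, Real.norm_eq_abs, Nat.abs_cast]
      _ ≤ ‖hodge₁ N 0‖ := PiLp.norm_apply_le _ _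
  · have h01 : D2 (lac N) (e 0) (e 1) 0 = N := D2_lac_e0_e1_zero N
    have hc : hodge₂ N 0 1 = N := by rw [hodge₂_eq, h01]; simp
    calc K ≤ N := hN
      _ = ‖hodge₂ N 0 1‖ := by rw [hc, Real.norm_eq_abs, Nat.abs_cast]
      _ ≤ ‖hodge₂ N 0‖ := PiLp.norm_apply_le _ _

/-! ### Public interface of the velocity witness (for the quantitative companion `…LogSharp`) -/

/-- **The velocity witness `U_N = (∂₁u_N, −∂₀u_N, 0)` is smooth, compactly supported and divergence free**
(public wrapper of the construction above, for use by companion modules).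
[cite: GilbargTrudinger2001, Ch. 4 Problem 4.9 (a)] -/
theorem vel_smooth_compact_divFree (N : ℕ) :
    ContDiff ℝ ∞ (vel N) ∧ HasCompactSupport (vel N) ∧ VectorCalculus.IsDivFree (vel N) :=
  ⟨vel_contDiff N, vel_hasCompactSupport N, vel_isDivFree N⟩

/-- **Uniform vorticity bound and linear gradient growth of the velocity witness**: one `M > 0` with
`sup ‖curl U_N‖ ≤ M` for every `N`, while `(DU_N(0) e₀)₀ = ∂₀∂₁u_N(0) = N` (the missing logarithm of the
Beale–Kato–Majda estimate). [cite: MajdaBertozziCUP2002, Prop. 3.8 (3.83) and Lemma 4.6 (4.35)] -/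
theorem vel_curl_bound_and_gradient : ∃ M : ℝ, 0 < M ∧ ∀ N : ℕ,
    (∀ x, ‖curl (vel N) x‖ ≤ M) ∧ (N : ℝ) ≤ ‖fderiv ℝ (vel N) 0‖ := by
  obtain ⟨B₁, h1, hB₁⟩ := exists_abs_D2_lac_le (a := e 0) (c := e 2) (by simp)
  obtain ⟨B₂, h2, hB₂⟩ := exists_abs_D2_lac_le (a := e 1) (c := e 2) (by simp)
  obtain ⟨B₃, h3, hB₃⟩ := exists_abs_D2_lac_le (a := e 0) (c := e 0) (by simp)
  obtain ⟨B₄, h4, hB₄⟩ := exists_abs_D2_lac_le (a := e 1) (c := e 1) (by simp)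
  refine ⟨B₁ + B₂ + B₃ + B₄ + 1, by linarith, fun N => ⟨fun x => ?_, ?_⟩⟩
  · rw [curl_vel]
    refine (norm_combo_le _ _ _).trans ?_
    have := hB₁ N x; have := hB₂ N x; have := hB₃ N x; have := hB₄ N x
    have h5 : |-(D2 (lac N) (e 0) (e 0) x + D2 (lac N) (e 1) (e 1) x)| ≤ B₃ + B₄ := by
      rw [abs_neg]; exact (abs_add_le _ _).trans (by linarith)
    linarith
  · have hc : fderiv ℝ (vel N) 0 (e 0) 0 = N := by
      rw [fderiv_vel_apply_coord, D2_lac_e1_e0_zero N]; simp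
    calc (N : ℝ) = |fderiv ℝ (vel N) 0 (e 0) 0| := by rw [hc, Nat.abs_cast]
      _ ≤ ‖fderiv ℝ (vel N) 0 (e 0)‖ := by
          rw [← Real.norm_eq_abs]; exact PiLp.norm_apply_le _ _
      _ ≤ ‖fderiv ℝ (vel N) 0‖ * ‖e 0‖ := ContinuousLinearMap.le_opNorm _ _
      _ = ‖fderiv ℝ (vel N) 0‖ := by rw [norm_e, mul_one]

end Literature.Barriers.NavierStokesRegularity.SupNormCZ

end
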